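import Mathlib
import Summits.Ventures.PercRepro2.Defs
import Summits.Ventures.PercRepro2.Graph
import Summits.Ventures.PercRepro2.OneColourSwitch
import Summits.Ventures.PercRepro2.RegionHubSign
import Summits.Ventures.PercRepro2.SideSwitch
import Summits.Ventures.PercRepro2.SideSwitchFibre
import Summits.Ventures.PercRepro2.SideSwitchMono
import Summits.Ventures.PercRepro2.SideSwitchM9
import Summits.Ventures.PercRepro2.SideSwitchClosed
import Summits.Ventures.PercRepro2.SideSwitchComps
import Summits.Ventures.PercRepro2.TermSwitchDefs
import Summits.Ventures.PercRepro2.TermSwitchFibre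
import Summits.Ventures.PercRepro2.TermSwitchCompsFibre
import Summits.Ventures.PercRepro2.TermSwitchMono
import Summits.Ventures.PercRepro2.TermSwitchM9
import Summits.Ventures.PercRepro2.M9LoopTransfer
import Summits.Ventures.PercRepro2.M9PendantSeries
import Summits.Ventures.PercRepro2.M9DegreeTwoClass

/-!
# `m9` on the class «every non-mark is adjacent to `p` or `q`, or lies behind `{r, s}`» (blind
cell PercRepro2, p3 g21, 2026-08-27; `proofs/P3-CPNC.md` §18d)

A REGION BEHIND `{r, s}` is a vertex set `Z ∌ p, q` that an edge can only leave through `r` or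
`s` (`BehindRS`).  If, besides a region `Z` behind `{r, s}` and a region `Z'` behind `{p, q}`
(disjoint), every non-mark is adjacent to `p` or `q` or carries at most one non-loop edge, then
every `Sep`-colouring is a `sepH ∧ DZeroH` colouring for the terminal set `H = {r, s} ∪ Z`
(`sepH_of_sep2_behind`, `DZeroH_of_sep2_behind`; a vertex behind `{p, q}` is in no world of `H`,
`not_mem_KH_of_behind_pq`), so `m9SignSum = dzeroSignSumH ≤ 0`
(`m9SignSum_nonpos_of_adj_or_behind`).  The vertices of `Z`, `Z'` may have any degree and be
doubly reached; the class is not contained in the DZero / cut-vertex / series–parallel /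
no-pocket classes (two adjacent vertices of degree `3` behind `{r, s}`).  Own work; std axioms.
-/

namespace Summit.Ventures.PercRepro2

namespace TermSwitch

open Finset Classical RegionHub OneColourSwitch SideSwitch

variable {V : Type*} {E : Type*}

variable (ends : E → Sym2 V)

/-- `Z` is a region behind `{r, s}`: an edge from `Z` ends in `Z`, `r` or `s`. -/
def BehindRS (r s : V) (Z : Set V) : Prop :=
  ∀ e x y, ends e = s(x, y) → x ∈ Z → y ≠ r → y ≠ s → y ∈ Z

variable {ends}

/-- No vertex of a region behind `{r, s}` is joined to a vertex outside `Z ∪ K₂`: the set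
`Z ∪ K₂` is closed under open edges. -/
lemma not_conn_of_behind {r s : V} {Z : Set V} (hZ : BehindRS ends r s Z) {ω : Config E}
    {x y : V} (hx : x ∈ Z) (hyZ : y ∉ Z) (hyK : y ∉ K2 ends r s ω) (hc : Conn ends ω x y) :
    False := by
  have hcl : ∀ a ∈ Z ∪ K2 ends r s ω, ∀ b, (openGraph ends ω).Adj a b →
      b ∈ Z ∪ K2 ends r s ω := by
    intro a ha b hab
    obtain ⟨_, e, he, hends⟩ := openGraph_adj.1 hab
    rcases ha with haZ | haK
    · by_cases hbr : b = r
      · rw [hbr]; exact Or.inr (r_mem_K2 r s ω)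
      by_cases hbs : b = s
      · rw [hbs]; exact Or.inr (s_mem_K2 r s ω)
      exact Or.inl (hZ e a b hends haZ hbr hbs)
    · exact Or.inr (mem_K2_of_open haK he hends)
  rcases mem_of_conn_of_closed hcl (Or.inl hx) hc with h1 | h1
  · exact hyZ h1
  · exact hyK h1

/-- Under `Sep`, a `Sep`-colouring separates `p, q` from the terminal set `{r, s} ∪ Z`. -/
lemma sepH_of_sep2_behind {p q r s : V} {Z : Set V} (hZ : BehindRS ends r s Z) (hpZ : p ∉ Z)
    (hqZ : q ∉ Z) {ω : Config E} (h : sep2 ends p q r s ω) :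
    sepH ends p q (insert r (insert s Z)) ω := by
  obtain ⟨hpK, hqK⟩ := not_mem_K2_of_sep2 h
  obtain ⟨hpM, hqM⟩ := not_mem_M2_of_sep2 h
  have key : ∀ {ω' : Config E} {a : V}, a ∉ Z →
      a ∉ K2 ends r s ω' → a ∉ KH ends (insert r (insert s Z)) ω' := by
    intro ω' a haZ haK ⟨h₀, hh₀, hc⟩
    rcases Set.mem_insert_iff.1 hh₀ with rfl | hh₀'
    · exact haK (mem_K2_iff.2 (Or.inl hc))
    rcases Set.mem_insert_iff.1 hh₀' with rfl | hh₀''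
    · exact haK (mem_K2_iff.2 (Or.inr hc))
    · exact not_conn_of_behind hZ hh₀'' haZ haK hc
  refine ⟨key hpZ hpK, key hqZ hqK, ?_, ?_⟩
  · have := key hpZ (by rw [K2_compl]; exact hpM)
    rwa [KH_compl] at this
  · have := key hqZ (by rw [K2_compl]; exact hqM)
    rwa [KH_compl] at this

/-- Under `Sep`, a vertex of a region behind `{p, q}` lies in no world of the terminal set
`{r, s} ∪ Z`, for a region `Z` behind `{r, s}` disjoint from it. -/
lemma not_mem_KH_of_behind_pq {p q r s : V} {Z Z' : Set V} (hZ : BehindRS ends r s Z)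
    (hpZ : p ∉ Z) (hqZ : q ∉ Z) (hZ' : BehindRS ends p q Z') (hrZ' : r ∉ Z') (hsZ' : s ∉ Z')
    (hdisj : ∀ x, x ∈ Z → x ∉ Z') {ω : Config E} (h : sep2 ends p q r s ω) {x : V}
    (hx : x ∈ Z') : x ∉ KH ends (insert r (insert s Z)) ω := by
  rintro ⟨h₀, hh₀, hc⟩
  obtain ⟨hpK, hqK⟩ := not_mem_K2_of_sep2 h
  obtain ⟨⟨hpr, hps, hqr, hqs⟩, _⟩ := h
  -- `r, s` are outside the `Y`-world of `{p, q}`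
  have hrK : r ∉ K2 ends p q ω := fun hr => by
    rcases mem_K2_iff.1 hr with hc' | hc'
    · exact hpr hc'
    · exact hqr hc'
  have hsK : s ∉ K2 ends p q ω := fun hs => by
    rcases mem_K2_iff.1 hs with hc' | hc'
    · exact hps hc'
    · exact hqs hc'
  rcases Set.mem_insert_iff.1 hh₀ with rfl | hh₀'
  · exact not_conn_of_behind hZ' hx hrZ' hrK (conn_symm hc)
  rcases Set.mem_insert_iff.1 hh₀' with rfl | hh₀''
  · exact not_conn_of_behind hZ' hx hsZ' hsK (conn_symm hc)
  · -- `h₀ ∈ Z` is outside `Z'` and outside the `Y`-world of `{p, q}`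
    have hK : h₀ ∉ K2 ends p q ω := fun hk => by
      rcases mem_K2_iff.1 hk with hc' | hc'
      · exact not_conn_of_behind hZ hh₀'' hpZ hpK (conn_symm hc')
      · exact not_conn_of_behind hZ hh₀'' hqZ hqK (conn_symm hc')
    exact not_conn_of_behind hZ' hx (hdisj h₀ hh₀'') hK (conn_symm hc)

section Count

variable [Fintype V] [DecidableEq V] [Fintype E] [DecidableEq E]

omit [Fintype V] [DecidableEq V] in
/-- A vertex outside `H` with at most one non-loop edge lies in at most one world of `H`. -/
lemma not_mem_both_H_of_degree_le_one {H : Set V} {x : V}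
    (hx : (M9Reduce.nonloopEdges ends x).card ≤ 1) (hxH : x ∉ H) {ω : Config E}
    (hK : x ∈ KH ends H ω) (hM : x ∈ MH ends H ω) : False := by
  -- an open non-loop edge at `x` from the `Y`-reach, a closed one from the `W`-reach
  have hY : ∃ e, x ∈ ends e ∧ ¬ (ends e).IsDiag ∧ ω e = true := by
    by_contra hno
    push Not at hno
    obtain ⟨h, hh, hc⟩ := hK
    exact hxH ((M9Reduce.eq_of_conn_of_loops (fun e he ho => by
      by_contra hnd; exact absurd ho (by simpa using hno e he hnd)) hc) ▸ hh)
  have hW : ∃ e, x ∈ ends e ∧ ¬ (ends e).IsDiag ∧ ω e = false := by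
    by_contra hno
    push Not at hno
    obtain ⟨h, hh, hc⟩ := hM
    exact hxH ((M9Reduce.eq_of_conn_of_loops (ω := OneColourSwitch.compl ω) (fun e he ho => by
      by_contra hnd
      have : ω e = false := by simpa [OneColourSwitch.compl] using ho
      exact absurd this (by simpa using hno e he hnd)) hc) ▸ hh)
  obtain ⟨e₁, he₁, hd₁, ho₁⟩ := hY
  obtain ⟨e₂, he₂, hd₂, ho₂⟩ := hW
  have hne : e₁ ≠ e₂ := fun h => by rw [h, ho₂] at ho₁; exact Bool.false_ne_true ho₁
  have hsub : ({e₁, e₂} : Finset E) ⊆ M9Reduce.nonloopEdges ends x := by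
    intro e he
    rcases Finset.mem_insert.1 he with rfl | he
    · exact M9Reduce.mem_nonloopEdges.2 ⟨he₁, hd₁⟩
    · rw [Finset.mem_singleton.1 he]; exact M9Reduce.mem_nonloopEdges.2 ⟨he₂, hd₂⟩
  have h2 : ({e₁, e₂} : Finset E).card = 2 := Finset.card_pair hne
  have := Finset.card_le_card hsub
  omega

omit [Fintype V] [DecidableEq V] in
/-- Under `Sep`, when every non-mark outside `Z ∪ Z'` is adjacent to `p` or `q` or carries at
most one non-loop edge, no vertex outside `{r, s} ∪ Z` lies in both worlds of `{r, s} ∪ Z`. -/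
lemma DZeroH_of_sep2_behind {p q r s : V} {Z Z' : Set V} (hZ : BehindRS ends r s Z)
    (hpZ : p ∉ Z) (hqZ : q ∉ Z) (hZ' : BehindRS ends p q Z') (hrZ' : r ∉ Z') (hsZ' : s ∉ Z')
    (hdisj : ∀ x, x ∈ Z → x ∉ Z')
    (hadj : ∀ x, Nonmark p q r s x → x ∉ Z → x ∉ Z' →
      (∃ e, ends e = s(x, p) ∨ ends e = s(x, q)) ∨ (M9Reduce.nonloopEdges ends x).card ≤ 1)
    {ω : Config E} (h : sep2 ends p q r s ω) :
    DZeroH ends (insert r (insert s Z)) ω := by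
  intro y hyH hyK hyM
  obtain ⟨hpK, hqK, hpM, hqM⟩ := sepH_of_sep2_behind hZ hpZ hqZ h
  have hyZ' : y ∉ Z' := fun hy => not_mem_KH_of_behind_pq hZ hpZ hqZ hZ' hrZ' hsZ' hdisj h hy hyK
  have hyr : y ≠ r := fun h => hyH (by rw [h]; exact Set.mem_insert r _)
  have hys : y ≠ s := fun h => hyH (by rw [h]; exact Set.mem_insert_of_mem r (Set.mem_insert s Z))
  have hyZ : y ∉ Z := fun h => hyH (Set.mem_insert_of_mem r (Set.mem_insert_of_mem s h))
  have hyp : y ≠ p := fun h => hpK (by rw [← h]; exact hyK)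
  have hyq : y ≠ q := fun h => hqK (by rw [← h]; exact hyK)
  rcases hadj y ⟨hyp, hyq, hyr, hys⟩ hyZ hyZ' with ⟨e, he⟩ | hdeg
  · cases hc : ω e with
    | true =>
      rcases he with he | he
      · exact hpK (mem_KH_of_open hyK hc he)
      · exact hqK (mem_KH_of_open hyK hc he)
    | false =>
      rcases he with he | he
      · exact hpM (mem_MH_of_closed hyM hc he)
      · exact hqM (mem_MH_of_closed hyM hc he)
  · exact not_mem_both_H_of_degree_le_one hdeg hyH hyK hyM

/-- **`m9` on the class «every non-mark is adjacent to `p` or `q`, has at most one non-loop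
edge, or lies in a region behind `{r, s}` or in a region behind `{p, q}`»**:
`Σ_{Sep} σ_pq · σ_rs ≤ 0`. -/
theorem m9SignSum_nonpos_of_adj_or_behind {p q r s : V} {Z Z' : Set V}
    (hZ : BehindRS ends r s Z) (hpZ : p ∉ Z) (hqZ : q ∉ Z)
    (hZ' : BehindRS ends p q Z') (hrZ' : r ∉ Z') (hsZ' : s ∉ Z') (hdisj : ∀ x, x ∈ Z → x ∉ Z')
    (hadj : ∀ x, Nonmark p q r s x → x ∉ Z → x ∉ Z' →
      (∃ e, ends e = s(x, p) ∨ ends e = s(x, q)) ∨ (M9Reduce.nonloopEdges ends x).card ≤ 1) :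
    m9SignSum ends p q r s ≤ 0 := by
  have hr : r ∈ insert r (insert s Z) := Set.mem_insert r _
  have hs : s ∈ insert r (insert s Z) := Set.mem_insert_of_mem r (Set.mem_insert s Z)
  have heq : m9SignSum ends p q r s = dzeroSignSumH ends p q r s (insert r (insert s Z)) := by
    unfold m9SignSum dzeroSignSumH
    refine Finset.sum_congr rfl (fun ω _ => ?_)
    by_cases h : sep2 ends p q r s ω
    · have h1 := sepH_of_sep2_behind hZ hpZ hqZ h
      have h2 := DZeroH_of_sep2_behind hZ hpZ hqZ hZ' hrZ' hsZ' hdisj hadj h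
      rw [if_pos h, if_pos ⟨h1, h2⟩]
    · have h' : ¬ (sepH ends p q (insert r (insert s Z)) ω ∧
          DZeroH ends (insert r (insert s Z)) ω) := fun h'' => h (sep2_of_sepH hr hs h''.1)
      rw [if_neg h, if_neg h']
  rw [heq]
  exact dzeroSignSumH_nonpos p q s hr

end Count

end TermSwitch

end Summit.Ventures.PercRepro2
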